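import Literature.NumberTheory.EllipticCurves.KezukaLi2020.CubeSumThreePart
import Literature.NumberTheory.EllipticCurves.Selmer
import Literature.NumberTheory.EllipticCurves.RootNumber
import Mathlib.NumberTheory.NumberField.ClassNumber
import HarnessLib

/-!
# Kezuka–Li 2020 (Doc. Math. 25), Thm. 1.3 and Prop. 4.6 AS PRINTED — the prime `2` for the rank-one cube-sum curves `C_{2p}` (`p ≡ 2 mod 9`), `C_{2p²}` (`p ≡ 5 mod 9`): `Ш(C)[2] ≠ 0 ⟺ rank₂ Cl(ℚ(∛p)) ≥ 2`, and `dim_{𝔽₂} Sel₂(C_{2p^j}) ∈ {k, k + 1}` by the root number, `k = rank₂ Cl(ℚ(∛p))`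

HONEST FRAMING (cell `bsd-print-cf2`, D-0131 (2) PRINT TIER, typer seat `ty1`; HOME
`run/shared/lean/pub/bsd-print-cf2/`): PUBLISHED theorems vendored as named `Prop`s (nothing
asserted, nothing discharged; D-0014), every printed hypothesis a binder, locators into the held
text. These are statements AT the prime `2` for CM curves of analytic rank one (`K = ℚ(√−3)`, `2`
INERT) — members of the cell's leaf CornerF @ `2` — but they are `2`-DESCENT statements (the
ALGEBRAIC side: `Sel₂`, `Ш[2]`), NOT the `2`-part of the Birch–Swinnerton-Dyer formula: no printed
source computes `ord₂ #Ш(C_{2p})_an`. What they give the cell: on the sub-family `rank₂ Cl(ℚ(∛p)) ≤ 1`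
the `2`-primary part of `Ш(C_{2p})` resp. `Ш(C_{2p²})` is TRIVIAL (Thm. 1.3, "iff"), so there `BSD₂`
is the single analytic identity `ord₂ (L'(C,1)/(Ω · Reg) · #tor²/∏c_v) = 0` (a finite abelian
`2`-group with trivial `2`-torsion is trivial); on `rank₂ ≥ 2` it is `Ш(C)[2] ≠ 0` with `#Ш(C)[2^∞]`
undetermined in print. This file is STATEMENT-ONLY (consumers derive `Ш[2] = 0` on `rank₂ ≤ 1` in
one line from the "iff" of `thm13_sha_two_iff_twoRank`). The companion file
`KezukaLi2020/CubeSumThreePart.lean` (cell `b2b-bsdres`) holds Cor. 1.2 (the `3`-part); this file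
adds the paper's "second main result". Nothing is booked here.

Source. Y. Kezuka, Y. Li, *A classical family of elliptic curves having rank one and the
`2`-primary part of their Tate–Shafarevich group non-trivial*, Doc. Math. **25** (2020) 2115–2147,
doi:10.4171/dm/795 [KezukaLi2020] (PUBLISHED, refereed; EMS open access). Text read: the journal
PDF, lit store key `paper:doi-10-4171-dm-795` (`pNNNN` = PDF page, printed page = 2114 + NNNN).

## The printed statements (verbatim)

* Set-up (p. 2115 = p0001 L29–L42): "Let `n ≥ 3` be a cube free integer. The elliptic curve
  `C_n : x³ + y³ = n` is the twist of `C : x³ + y³ = 1` by the cubic field `ℚ(∛n)` … it is well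
  known that `C_n` has no non-zero rational torsion, and thus `C_n(ℚ)` is infinite precisely when
  `n` is the sum of two rational cubes. Let `p` be any odd prime satisfying
  (1.1) `p ≡ 2 mod 9` or `p ≡ 5 mod 9`. In [20], Satgé used the theory of Heegner points to show
  that `C_{2p}` has rank `1` when `p ≡ 2 mod 9`, and `C_{2p²}` has rank `1` when `p ≡ 5 mod 9`."
  Notation (p. 2118 = p0004 L28–L29): "An odd prime `p` is always assumed satisfying the condition
  (1.1)"; (p. 2116 L47) "We write `Ш(C_n)` for the Tate–Shafarevich group of `C_n` over `ℚ`."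
* The `2`-rank (p. 2117 = p0003 L21–L24): "Given a number field `F`, let `Cl(F)` be the ideal class
  group of `F`. We call the integer `rank₂(Cl(F)) := dim_{𝔽₂}(Cl(F)/2Cl(F))` the `2`-rank of
  `Cl(F)`." The field (p0003 L10–L11): "the `2`-part of the ideal class group of the field
  `L = ℚ(∛p)`" ("`∛n` denotes the real root", p. 2115). (p. 2143 = p0029 L17: "Note that
  `#(Cl(L)[2]) = #(Cl(L)/2Cl(L))`, since `Cl(L)` is a finite group.")
* **Theorem 1.3** (p. 2117 = p0003 L25–L31): "Let `p` be an odd prime satisfying (1.1).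
  1. If `p ≡ 2 mod 9`, we have `rank₂(Cl(L)) ≥ 2` if and only if `Ш(C_{2p})[2]` is non-trivial. In
  particular, in the case `rank₂(Cl(L)) ≥ 2`, the curve `C_{2p}` has rank `1` and has non-trivial
  `Ш(C_{2p})[2]`.
  2. If `p ≡ 5 mod 9`, we have `rank₂(Cl(L)) ≥ 2` if and only if `Ш(C_{2p²})[2]` is non-trivial. In
  particular, in the case `rank₂(Cl(L)) ≥ 2`, the curve `C_{2p²}` has rank `1` and has non-trivial
  `Ш(C_{2p²})[2]`." (p0003 L32–L34: "although we cannot show at present that there are infinitely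
  many primes `p` satisfying the condition `rank₂(Cl(L)) ≥ 2` in Theorem 1.3, there are many such
  `p`. Indeed, for `p < 1000000`, `1852/13099` of the primes `p ≡ 2 mod 9` and `1629/13068` of the
  primes `p ≡ 5 mod 9` satisfy the condition.")
* §4, the model (4.1) (p. 2139 = p0025 L29–L36): "Given `j ∈ {1, 2}`, the curve `C_{2p^j}` is a twist
  of `C₂` by the cubic extension `ℚ(∛(p^j))/ℚ` of discriminant prime to `2`. Since a global minimal
  Weierstrass model of `C₂` is given by `y² = x³ − 27`, we know that `y² = x³ − 27p^{2j}` (`j = 1, 2`)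
  (4.1) gives a minimal model of `C_{2p^j}` at `2`. In the remainder of this section, we write `E` for
  `C_{2p^j}` for simplicity, and we work with the equation given in (4.1). We will study the relation
  between the `2`-class group of `L = ℚ(∛p)` and the `2`-Selmer group `Sel₂(E)`. It is well known
  that the torsion part `E(ℚ)_tor` of `E(ℚ)` is trivial".
* **Proposition 4.6** (p. 2142 = p0028 L95–L102): "Write `ε(E/ℚ)` for the global root number of
  `E/ℚ`. … Proposition 4.6. Let `k = rank₂(Cl(L))`. Then `dim_{𝔽₂} Sel₂(E) = k` if
  `ε(E/ℚ) = (−1)^k`, `= k + 1` if `ε(E/ℚ) = (−1)^{k+1}`." Proof (p. 2143): `N₁ ⊆ Sel₂(E) ⊆ N₂` with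
  `#N₁ = 2^k` (Kummer theory, `Gal(M/L) = Cl(L)[2]`), `dim N₂ = k + 1` (Dirichlet's unit theorem for
  the cubic field `L`, one fundamental unit), "and the 2-parity conjecture proved in [13]"
  (Monsky 1996); "This also concludes the proof of Theorem 1.3."

## The `p = 2` flag of this file

AT-2 and ALGEBRAIC: `Sel₂`, `Ш[2]`, `rank₂ Cl(ℚ(∛p))`. No `L`-value enters; the `2`-part of the BSD
formula for `C_{2p}`, `C_{2p²}` is NOT asserted anywhere in the source (nor in Cai–Shu–Tian 2017,
whose Thm. 1.2 excludes `ℓ = 2`: tree `CaiShuTian2017.thm12_bsd_cubeSum_twicePrime`).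

## Transcription (tree dictionary)

* `C_{2p^j}` (`j = 1, 2`) IS the printed model (4.1) `y² = x³ − 27 p^{2j}` = the tree's
  `KezukaLi2020.cubeSumTwoModel p j` ("we work with the equation given in (4.1)"); `Ш(C_n)` over `ℚ`
  = `WeierstrassCurve.sha` (`Sha.lean`); "`Ш(C)[2]` is non-trivial" = `∃ x ∈ Ш, x ≠ 0 ∧ 2 • x = 0`;
  "has rank `1`" = `mordellWeilRank = 1`; `Sel₂(E)` = the tree's `2`-Selmer group over `ℚ`,
  `WeierstrassCurve.selmerGroup E 2 ⊆ H¹(ℚ, E[2])` (`Selmer.lean`; the same object as in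
  `HeathBrown1994.monsky_card_selmerGroup_two_odd`), and "`dim_{𝔽₂} Sel₂(E) = d`" is rendered
  `Nat.card (Sel₂(E)) = 2^d` (an elementary abelian `2`-group); `ε(E/ℚ)` = the tree's analytic root
  number `WeierstrassCurve.rootNumber` (`RootNumber.lean`, the sign of the functional equation; the
  same reading as `rootNumber_cubeSumCurve_prime_eq_neg_one_of_mod_nine`).
* "`L = ℚ(∛p)`": a number field `L` with `[L : ℚ] = 3` containing a cube root of `p`
  (`IsCubicFieldOfCbrt L p`; for a prime `p`, `X³ − p` is irreducible, so every such `L` is `ℚ(θ)`,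
  and the three conjugate fields are isomorphic — the rendering of "the field `ℚ(√d)`" used by
  `Tian2014.IsQuadraticFieldOfSqrt` and of "`K` of degree `3`, `θ³ = ab²`" used by the tree's
  `NumberFields.PureCubic*` files).
* "`rank₂(Cl(F)) := dim_{𝔽₂}(Cl(F)/2Cl(F))`": `classGroupTwoRank F := log₂ #(Cl(F)/Cl(F)²)` with
  `Cl(F) = ClassGroup (𝓞 F)` (Mathlib, written multiplicatively; `Cl(F)² = range (x ↦ x²)`), a
  definition with body; `#(Cl/Cl²)` is a power of `2`, so `log₂` is the printed `𝔽₂`-dimension.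
No `_holds` is expected soon (a full `2`-descent over the cubic field `ℚ(∛p)` with the local images
of Lemma 4.5, Kummer theory and Monsky's `2`-parity theorem). Consumers take
`(h : thm13_sha_two_iff_twoRank)` etc.

## References
* [KezukaLi2020] Y. Kezuka, Y. Li, Doc. Math. 25 (2020) 2115–2147: p. 2115 (set-up, (1.1)),
  p. 2117 (the `2`-rank; Thm. 1.3), p. 2118 (Notation), (4.1) p. 2139, Prop. 4.6 p. 2142, proof
  p. 2143, Appendix A (numerical examples).
* P. Satgé, *Un analogue du calcul de Heegner*, Invent. Math. 87 (1987) 425–439 (KL's [20]).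
* P. Monsky, *Generalizing the Birch–Stephens theorem. I. Modular curves*, Math. Z. 221 (1996)
  415–420 (KL's [13], the `2`-parity input).
* [CaiShuTian2017] L. Cai, J. Shu, Y. Tian, Amer. J. Math. 139 (2017), Thm. 1.2 (KL's [2]).
-/

noncomputable section

open scoped Classical NumberField

open NumberField WeierstrassCurve Literature.NumberTheory.EllipticCurves

namespace Literature.NumberTheory.EllipticCurves.KezukaLi2020

/-! ### §1. Vocabulary (definitions with bodies; nothing asserted) -/

/-- "`L = ℚ(∛d)`" for a number field `L` and an integer `d`: `[L : ℚ] = 3` and `d` has a cube root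
in `L` (for `d` not a rational cube this pins `L` down, up to isomorphism, as `ℚ(∛d)`; used below
with `d = p` prime). Kezuka–Li 2020, p. 2117: "the field `L = ℚ(∛p)`".
[cite: KezukaLi2020, p. 2117 (PDF p0003 L10–L11) and §4 p. 2139] -/
def IsCubicFieldOfCbrt (L : Type*) [Field L] [NumberField L] (d : ℤ) : Prop :=
  Module.finrank ℚ L = 3 ∧ ∃ θ : L, θ ^ 3 = (d : L)

/-- Unfolding of `IsCubicFieldOfCbrt`. [cite: KezukaLi2020, p. 2117 (PDF p0003 L10–L11)] -/
theorem isCubicFieldOfCbrt_iff (L : Type*) [Field L] [NumberField L] (d : ℤ) :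
    IsCubicFieldOfCbrt L d ↔ Module.finrank ℚ L = 3 ∧ ∃ θ : L, θ ^ 3 = (d : L) :=
  Iff.rfl

/-- **The `2`-rank of the class group** of a number field `F` (Kezuka–Li 2020, p. 2117):
"`rank₂(Cl(F)) := dim_{𝔽₂}(Cl(F)/2Cl(F))`", rendered as `log₂` of the (finite, `2`-power)
cardinality of `Cl(F)/Cl(F)²`, `Cl(F) = ClassGroup (𝓞 F)` written multiplicatively
(`Cl(F)² = (powMonoidHom 2).range`). By p. 2143, "`#(Cl(L)[2]) = #(Cl(L)/2Cl(L))`".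
[cite: KezukaLi2020, p. 2117 (PDF p0003 L21–L24), p. 2143 (PDF p0029 L17)] -/
def classGroupTwoRank (F : Type*) [Field F] [NumberField F] : ℕ :=
  Nat.log 2 (Nat.card (ClassGroup (𝓞 F) ⧸ (powMonoidHom 2 : ClassGroup (𝓞 F) →* _).range))

/-- Unfolding of `classGroupTwoRank`. [cite: KezukaLi2020, p. 2117 (PDF p0003 L21–L24)] -/
theorem classGroupTwoRank_def (F : Type*) [Field F] [NumberField F] :
    classGroupTwoRank F =
      Nat.log 2 (Nat.card (ClassGroup (𝓞 F) ⧸ (powMonoidHom 2 : ClassGroup (𝓞 F) →* _).range)) :=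
  rfl

/-! ### §2. The printed theorems (named facts; nothing asserted) -/

/-- **Kezuka–Li, Doc. Math. 25 (2020), Theorem 1.3** (verbatim in the module docstring): "Let `p`
be an odd prime satisfying (1.1) [`p ≡ 2` or `5 mod 9`]. 1. If `p ≡ 2 mod 9`, we have
`rank₂(Cl(L)) ≥ 2` if and only if `Ш(C_{2p})[2]` is non-trivial. In particular, in the case
`rank₂(Cl(L)) ≥ 2`, the curve `C_{2p}` has rank `1` and has non-trivial `Ш(C_{2p})[2]`. 2. If
`p ≡ 5 mod 9`, we have `rank₂(Cl(L)) ≥ 2` if and only if `Ш(C_{2p²})[2]` is non-trivial. In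
particular, in the case `rank₂(Cl(L)) ≥ 2`, the curve `C_{2p²}` has rank `1` and has non-trivial
`Ш(C_{2p²})[2]`" (`L = ℚ(∛p)`; `C_{2p^j}` on the model (4.1) `y² = x³ − 27p^{2j}`). Transcription
(module docstring): `L` any number field with `[L : ℚ] = 3` and a cube root of `p`;
`rank₂ = classGroupTwoRank L`; `C_{2p^j} = cubeSumTwoModel p j`; "`Ш[2]` non-trivial" =
`∃ x ∈ Ш, x ≠ 0 ∧ 2 • x = 0`. An ALGEBRAIC statement at `2`; no BSD₂ claim. PUBLISHED (refereed).
[cite: KezukaLi2020, Thm. 1.3 (p. 2117 = PDF p0003 L25–L31), (4.1) (p. 2139), proof p. 2143] -/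
def thm13_sha_two_iff_twoRank : Prop :=
  ∀ (p : ℕ), p.Prime → p ≠ 2 → ∀ (j : ℕ), (p % 9 = 2 ∧ j = 1) ∨ (p % 9 = 5 ∧ j = 2) →
    ∀ (L : Type) [Field L] [NumberField L], IsCubicFieldOfCbrt L p →
      (2 ≤ classGroupTwoRank L ↔
          ∃ x : (cubeSumTwoModel p j).sha, x ≠ 0 ∧ (2 : ℕ) • x = 0) ∧
      (2 ≤ classGroupTwoRank L →
          (cubeSumTwoModel p j).mordellWeilRank = 1 ∧
            ∃ x : (cubeSumTwoModel p j).sha, x ≠ 0 ∧ (2 : ℕ) • x = 0)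

/-- **Kezuka–Li, Doc. Math. 25 (2020), Proposition 4.6** (verbatim in the module docstring; §4's
standing data: `p` an odd prime with `p ≡ 2` or `5 mod 9`, `j ∈ {1, 2}`, `E = C_{2p^j}` on the model
(4.1) `y² = x³ − 27p^{2j}`, `L = ℚ(∛p)`, `ε(E/ℚ)` the global root number): "Let `k = rank₂(Cl(L))`.
Then `dim_{𝔽₂} Sel₂(E) = k` if `ε(E/ℚ) = (−1)^k`, `= k + 1` if `ε(E/ℚ) = (−1)^{k+1}`."
Transcription (module docstring): `Sel₂(E)` = `WeierstrassCurve.selmerGroup E 2` over `ℚ` with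
`#Sel₂(E) = 2^{dim}`; `ε(E/ℚ)` = `WeierstrassCurve.rootNumber E`; `k = classGroupTwoRank L`. BOTH
`j = 1` and `j = 2` for each `p` (the rank-zero member included), as printed. PUBLISHED (refereed).
[cite: KezukaLi2020, Prop. 4.6 (p. 2142 = PDF p0028 L95–L102), (4.1) (p. 2139), proof p. 2143] -/
def prop46_card_selmerGroup_two : Prop :=
  ∀ (p : ℕ), p.Prime → p ≠ 2 → (p % 9 = 2 ∨ p % 9 = 5) → ∀ (j : ℕ), (j = 1 ∨ j = 2) →
    ∀ (L : Type) [Field L] [NumberField L], IsCubicFieldOfCbrt L p →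
      ((cubeSumTwoModel p j).rootNumber = (-1) ^ classGroupTwoRank L →
          Nat.card ((cubeSumTwoModel p j).selmerGroup 2) = 2 ^ classGroupTwoRank L) ∧
      ((cubeSumTwoModel p j).rootNumber = (-1) ^ (classGroupTwoRank L + 1) →
          Nat.card ((cubeSumTwoModel p j).selmerGroup 2) = 2 ^ (classGroupTwoRank L + 1))

end Literature.NumberTheory.EllipticCurves.KezukaLi2020
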